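import Summits.QuantumFields.GaugeBoot.ZdTwistedTraceLoops
import Summits.QuantumFields.GaugeBoot.HolonomyGauge
import HarnessLib

/-!
# `ℤ^d`: the holonomy gauge — every link variable becomes a closed-word holonomy at the origin (gauge-boot, FFT/ℤ^d 2/3)

HONEST FRAMING (cell `pub-gaugeboot`, page 1 of every file): the venture produces certified bounds
on lattice expectations at stated coupling, gauge group, dimension and torus size; NOT a mass gap,
NOT a continuum limit, NOT a string tension; NOT Yang–Mills-summit-bearing (barriers
`FixedCouplingUltralocality`, `PerturbativeInvisibility`). Bookkeeping on `ℤ^d`; no number is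
certified. The `ℤ^d` twin of `HolonomyGauge.lean`.

## Content (`ℤ^d`, topological group `G`, `r : LatticeRep G`)

* `basePathZd x` (a word from `0` to `x`), `pathGaugeZd U x = hol_0(basePathZd x)(U)`,
  `edgeLoopZd e` (closed word at `0` through the link `e`); ★ `gaugeTransformZd_pathGaugeZd_apply` —
  in the holonomy gauge every link variable of `ℤ^d` is `hol_0` of a closed word; `pathGaugeZdCM`.
* `entryCZd`, `polyAlgebraCZd` (complex polynomial LOCAL observables: finitely generated
  expressions in entries of finitely many links and their conjugates), `lineAlgebraCZd`;
  `star_lineCZd_of_closed`; ★★ `comp_pathGaugeZdCM_mem_lineAlgebraCZd`,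
  `mem_lineAlgebraCZd_of_isZdGaugeInvariant` — a gauge-invariant complex polynomial observable on
  `ℤ^d` is a polynomial in the entries of closed-word holonomies at the origin.

References: M. Creutz, *Quarks, gluons and lattices* (1983) Ch. 9; B. Durhuus, Lett. Math. Phys. 4
(1980) 515–522. Folklore.
-/

noncomputable section

namespace Summit.QuantumFields.GaugeBoot

open Matrix TensorFFT
open Literature.MathematicalPhysics.QuantumFieldTheory (LatticeRep)
open Literature.MathematicalPhysics.QuantumLattice (LGConfig ZdEdge gaugeTransformZd IsZdGaugeInvariant)
open Literature.Probability.LatticeModels (Site)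

variable {d : ℕ} {G : Type*} [Group G]

/-! ## Paths from the origin and the holonomy gauge on `ℤ^d` -/

section Gauge

/-- **A lattice word from the origin to `x ∈ ℤ^d`** (a choice). [folklore] -/
def basePathZd (x : Site d) : Word d := Classical.choose (exists_wordZd_endpointZd (0 : Site d) x)

/-- `basePathZd x` ends at `x`. -/
@[simp] theorem endpointZd_basePathZd (x : Site d) : Word.endpointZd (0 : Site d) (basePathZd x) = x :=
  Classical.choose_spec (exists_wordZd_endpointZd (0 : Site d) x)

/-- **The closed word at the origin through the link `e = (x, i)`** of `ℤ^d`. [folklore] -/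
def edgeLoopZd (e : ZdEdge d) : Word d :=
  basePathZd e.1 ++ [Step.fwd e.2] ++ (basePathZd (e.1 + Pi.single e.2 1)).reverse

/-- `edgeLoopZd e` is closed at the origin. -/
@[simp] theorem endpointZd_edgeLoopZd (e : ZdEdge d) : Word.endpointZd (0 : Site d) (edgeLoopZd e) = 0 := by
  rw [edgeLoopZd, Word.endpointZd_append, Word.endpointZd_append, endpointZd_basePathZd]
  have h : Word.endpointZd e.1 [Step.fwd e.2] = e.1 + Pi.single e.2 1 := rfl
  rw [h]
  have h3 := Word.endpointZd_reverse (0 : Site d) (basePathZd (e.1 + Pi.single e.2 1))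
  rwa [endpointZd_basePathZd] at h3

/-- **The holonomy gauge transformation on `ℤ^d`**: at `x`, the holonomy along `basePathZd x`.
[folklore] -/
def pathGaugeZd (U : LGConfig d G) : Site d → G := fun x => wordHolonomyZd U 0 (basePathZd x)

/-- ★ **In the holonomy gauge every link variable of `ℤ^d` is a closed-word holonomy at the
origin**: `(U^{pathGaugeZd U})_e = hol_0(edgeLoopZd e)(U)`. [folklore] -/
theorem gaugeTransformZd_pathGaugeZd_apply (U : LGConfig d G) (e : ZdEdge d) :
    gaugeTransformZd (pathGaugeZd U) U e = wordHolonomyZd U 0 (edgeLoopZd e) := by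
  rw [edgeLoopZd, wordHolonomyZd_append, wordHolonomyZd_append, Word.endpointZd_append,
    endpointZd_basePathZd]
  have h1 : Word.endpointZd e.1 [Step.fwd e.2] = e.1 + Pi.single e.2 1 := rfl
  have h2 : wordHolonomyZd U e.1 [Step.fwd e.2] = U e := by
    simp only [wordHolonomyZd_cons, wordHolonomyZd_nil, stepHolonomyZd_fwd, mul_one]
  rw [h1, h2, wordHolonomyZd_reverse_of_endpoint U (endpointZd_basePathZd (e.1 + Pi.single e.2 1))]
  rfl

variable [TopologicalSpace G] [IsTopologicalGroup G]

/-- **The holonomy gauge on `ℤ^d` as a continuous self-map** of the configurations. [folklore] -/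
def pathGaugeZdCM : C(LGConfig d G, LGConfig d G) where
  toFun U := gaugeTransformZd (pathGaugeZd U) U
  continuous_toFun := by
    refine continuous_pi fun e => ?_
    simp only [gaugeTransformZd_pathGaugeZd_apply]
    exact continuous_wordHolonomyZd 0 (edgeLoopZd e)

/-- `pathGaugeZdCM` evaluated. -/
@[simp] theorem pathGaugeZdCM_apply (U : LGConfig d G) :
    pathGaugeZdCM (G := G) U = gaugeTransformZd (pathGaugeZd U) U := rfl

/-- **Gauge-invariant observables on `ℤ^d` do not see the holonomy gauge.** -/
theorem comp_pathGaugeZdCM_eq_of_isZdGaugeInvariant {β : Type*} [TopologicalSpace β]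
    {f : C(LGConfig d G, β)} (hf : IsZdGaugeInvariant (⇑f)) : f.comp pathGaugeZdCM = f := by
  ext U
  exact hf (pathGaugeZd U) U

end Gauge

/-! ## Complex polynomial observables and the line algebra at the origin of `ℤ^d` -/

section Algebras

variable [TopologicalSpace G] (r : LatticeRep G)

/-- **Complex matrix entry of a link variable on `ℤ^d`** `U ↦ ρ(U_e)_{ab}`. [folklore] -/
def entryCZd (e : ZdEdge d) (a b : Fin r.N) : C(LGConfig d G, ℂ) :=
  ⟨fun U => r.ρ (U e) a b, (r.continuous.comp (continuous_apply e)).matrix_elem a b⟩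

/-- `entryCZd` evaluated. -/
@[simp] theorem entryCZd_apply (e : ZdEdge d) (a b : Fin r.N) (U : LGConfig d G) :
    entryCZd r e a b U = r.ρ (U e) a b := rfl

/-- **The complex polynomial (local) observables on `ℤ^d`**: the unital `ℂ`-subalgebra generated by
the matrix entries of the link variables and their conjugates. [folklore] -/
def polyAlgebraCZd : Subalgebra ℂ C(LGConfig d G, ℂ) :=
  Algebra.adjoin ℂ ({f | ∃ e a b, f = entryCZd (d := d) r e a b} ∪ {f | ∃ e a b, f = star (entryCZd (d := d) r e a b)})

variable [IsTopologicalGroup G]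

/-- **The line algebra at `x` on `ℤ^d`**: generated by the entries of the holonomies of the closed
words at `x`. [folklore] -/
def lineAlgebraCZd (x : Site d) : Subalgebra ℂ C(LGConfig d G, ℂ) :=
  Algebra.adjoin ℂ {f | ∃ (w : Word d) (a b : Fin r.N), Word.endpointZd x w = x ∧ f = lineCZd r x w a b}

/-- Entries of closed-word holonomies are in the line algebra. -/
theorem lineCZd_mem_lineAlgebraCZd (x : Site d) {w : Word d} (hw : Word.endpointZd x w = x) (a b : Fin r.N) :
    lineCZd r x w a b ∈ lineAlgebraCZd (d := d) r x :=
  Algebra.subset_adjoin ⟨w, a, b, hw, rfl⟩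

/-- ★ Unitarity: `conj ρ(hol_x w)_{ab} = ρ(hol_x w⁻¹)_{ba}` for a closed word (`ℤ^d`). -/
theorem star_lineCZd_of_closed (x : Site d) {w : Word d} (hw : Word.endpointZd x w = x) (a b : Fin r.N) :
    star (lineCZd r x w a b) = (lineCZd r x w.reverse b a : C(LGConfig d G, ℂ)) := by
  ext U
  change (starRingEnd ℂ) (r.ρ (wordHolonomyZd U x w) a b) = r.ρ (wordHolonomyZd U x w.reverse) b a
  rw [wordHolonomyZd_reverse_of_endpoint U hw, rho_inv_apply]

/-- In the holonomy gauge a matrix entry is a closed-word line entry at the origin. -/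
theorem entryCZd_comp_pathGaugeZdCM (e : ZdEdge d) (a b : Fin r.N) :
    (entryCZd r e a b).comp pathGaugeZdCM = (lineCZd r 0 (edgeLoopZd e) a b : C(LGConfig d G, ℂ)) := by
  ext U
  change r.ρ (gaugeTransformZd (pathGaugeZd U) U e) a b = r.ρ (wordHolonomyZd U 0 (edgeLoopZd e)) a b
  rw [gaugeTransformZd_pathGaugeZd_apply]

/-- ★★ **In the holonomy gauge every complex polynomial observable on `ℤ^d` is a polynomial in
the entries of closed-word holonomies at the origin.** -/
theorem comp_pathGaugeZdCM_mem_lineAlgebraCZd {F : C(LGConfig d G, ℂ)} (hF : F ∈ polyAlgebraCZd r) :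
    F.comp pathGaugeZdCM ∈ lineAlgebraCZd (d := d) r 0 := by
  let ψ : C(LGConfig d G, ℂ) →ₐ[ℂ] C(LGConfig d G, ℂ) :=
    ContinuousMap.compRightAlgHom ℂ ℂ (pathGaugeZdCM (G := G) (d := d))
  have hψ : ∀ g : C(LGConfig d G, ℂ), ψ g = g.comp pathGaugeZdCM := fun g => rfl
  rw [← hψ]
  change F ∈ Subalgebra.comap ψ (lineAlgebraCZd r 0)
  refine (Algebra.adjoin_le ?_ : polyAlgebraCZd r ≤ Subalgebra.comap ψ (lineAlgebraCZd r 0)) hF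
  rintro g (⟨e, a, b, rfl⟩ | ⟨e, a, b, rfl⟩)
  · rw [SetLike.mem_coe, Subalgebra.mem_comap, hψ, entryCZd_comp_pathGaugeZdCM]
    exact lineCZd_mem_lineAlgebraCZd r 0 (endpointZd_edgeLoopZd e) a b
  · rw [SetLike.mem_coe, Subalgebra.mem_comap, hψ]
    have e1 : (star (entryCZd r e a b)).comp pathGaugeZdCM =
        star ((entryCZd r e a b).comp (pathGaugeZdCM (G := G) (d := d))) := rfl
    rw [e1, entryCZd_comp_pathGaugeZdCM, star_lineCZd_of_closed r 0 (endpointZd_edgeLoopZd e)]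
    exact lineCZd_mem_lineAlgebraCZd r 0 (by
      rw [← endpointZd_edgeLoopZd e, Word.endpointZd_reverse, endpointZd_edgeLoopZd]) b a

/-- ★★ **A gauge-invariant complex polynomial observable on `ℤ^d` lies in the line algebra at the
origin.** -/
theorem mem_lineAlgebraCZd_of_isZdGaugeInvariant {F : C(LGConfig d G, ℂ)} (hF : F ∈ polyAlgebraCZd r)
    (hFi : IsZdGaugeInvariant (⇑F)) : F ∈ lineAlgebraCZd (d := d) r 0 := by
  rw [← comp_pathGaugeZdCM_eq_of_isZdGaugeInvariant hFi]
  exact comp_pathGaugeZdCM_mem_lineAlgebraCZd r hF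

end Algebras

end Summit.QuantumFields.GaugeBoot

end
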